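import Mathlib.ModelTheory.Graph
import Literature.ModelTheory.FiniteModelTheory.CkEquiv
import HarnessLib

/-!
# The bijective `k`-pebble game on relational STRUCTURES (`StructCkEquiv`) and its agreement with
the tree's `CkEquiv` on graphs

Topic `Literature/ModelTheory/FiniteModelTheory`; follow-up to definition requests `defn-CkEquiv`
/ `defn-CountingWidth` (the routes PneNP/SymmetryBudget and PneNP/Descriptive play the game on
relational structures — graphs expanded by unary relations, CFI structures — not only on plain
graphs). The tree's `CkEquiv k G H` (`CkEquiv.lean`) is Hella's bijective `k`-pebble game on
GRAPHS with unlabelled positions; here: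

1. the same game on arbitrary `L`-STRUCTURES (Mathlib `L.Structure`; relational reading:
   partial isomorphisms respect equality and every RELATION symbol, function symbols are not
   inspected), with LABELLED pebble pairs — positions `PebblePosition k M N = Fin k → Option (M ×
   N)`, Duplicator's STRATEGY SPACES `PebbleStrategySpace` (sets of positions containing the
   empty one and closed under the bijective move "Spoiler lifts pair `i`, Duplicator names
   `f : M ≃ N`, Spoiler puts pair `i` on some `(a, f a)`"), and
   `StructCkEquiv L k M N` := some strategy space consists of partial isomorphisms. This is the
   game exactly as printed in Atserias–Dawar 2019, §2.1 (pebble pairs `(aᵢ, bᵢ)`, `i ≤ k`;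
   Libkin 2004, Def. 11.4 for labelled pebble positions). PROVED: isomorphic ⇒ equivalent
   (`StructCkEquiv.of_equiv`), monotone in `k` (`.mono`), `k ≥ 1` ⇒ equinumerous
   (`.nonempty_equiv`), `k ≥ |M|, |N|` ⇒ isomorphic for relational `L`
   (`.nonempty_lequiv_of_card_le`);
2. the PROVED bridge `ckEquiv_iff_structCkEquiv`: for simple graphs the tree's `CkEquiv k G H`
   (positions `p ⊆ V × W` of `≤ k` pairs, subset-closed back-and-forth systems, Grohe–Otto 2015
   §2) is equivalent to `StructCkEquiv Language.graph k` for `SimpleGraph.structure` — the two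
   textbook presentations of the game agree (`PebblePosition.isPartialIso_graph_iff` unfolds
   partial isomorphisms of `Language.graph`-structures to equality/adjacency compatibility).

Hella's theorem (game ⇔ `C^k` sentences) is proved on top of this file in `CountingLogic.lean`.

INDEXING as in `CkEquiv.lean`: `k` = number of pebble pairs = number of variables. `k = 0`:
`StructCkEquiv L 0 M N` iff `M`, `N` agree on the `0`-ary relation symbols (always, for graphs —
matching `CkEquiv.zero`).

## References

* L. Hella, *Logical hierarchies in PTIME*, Inform. and Comput. 129 (1996) 1–19 (the bijective
  `k`-pebble game; paywalled, acq-02317 — read through the restatements below).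
* A. Atserias, A. Dawar, *Definable inapproximability: new challenges for duplicator*, J. Logic
  Comput. 29 (2019), §2.1 (the `k`-pebble bijective game with pairs `(aᵢ, bᵢ)`). Read
  arXiv:1806.11307 pp. 6–7.
* M. Grohe, M. Otto, *Pebble games and linear equations*, J. Symb. Log. 80 (2015), §2, Thm 2.2
  (unlabelled positions; the tree's `CkEquiv`).
* L. Libkin, *Elements of Finite Model Theory* (2004), Def. 11.4 (pebble games with `k` labelled
  pairs of pebbles; positions as partial isomorphisms). Read pp. 236–239.
* A. Dawar, G. Wilsenach, *Symmetric arithmetic circuits*, Theory of Computing 21 (2025), §2.4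
  ("if k ≥ n then Γ ≡ₖ Δ implies that Γ and Δ are isomorphic").
-/

namespace Literature.ModelTheory.FiniteModelTheory

open FirstOrder FirstOrder.Language.Structure

universe u v w w'

/-! ### Positions and partial isomorphisms -/

/-- A POSITION of a `k`-pebble game on `M` and `N`: pebble pair `i : Fin k` is either off the
board (`none`) or placed on `(aᵢ, bᵢ) ∈ M × N`. [Libkin 2004, Def. 11.4; Atserias–Dawar 2019,
§2.1] [folklore] -/
abbrev PebblePosition (k : ℕ) (M : Type w) (N : Type w') : Type (max w w') :=
  Fin k → Option (M × N)

namespace PebblePosition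

variable {k : ℕ} {M : Type w} {N : Type w'}

/-- The empty position: all pebble pairs off the board. [folklore] -/
def empty : PebblePosition k M N := fun _ => none

/-- `(a, b)` is a PEBBLED PAIR of the position `p` (some pebble pair sits on `a` and `b`).
[folklore] -/
def Pebbled (p : PebblePosition k M N) (a : M) (b : N) : Prop :=
  ∃ i : Fin k, p i = some (a, b)

/-- The pebbled pairs of `p` respect EQUALITY: `aᵢ = aⱼ ↔ bᵢ = bⱼ`, i.e. `aᵢ ↦ bᵢ` is a
well-defined injective partial map. [Libkin 2004, Def. 11.4 ("F is the graph of a partial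
isomorphism")] [folklore] -/
def EqCompatible (p : PebblePosition k M N) : Prop :=
  ∀ ⦃a a' : M⦄ ⦃b b' : N⦄, p.Pebbled a b → p.Pebbled a' b' → (a = a' ↔ b = b')

/-- The pebbled pairs of `p` define a PARTIAL ISOMORPHISM of the `L`-structures `M`, `N`: they
respect equality and every RELATION symbol of `L` on pebbled tuples (function symbols are not
inspected — the intended reading is for relational `L`). [Libkin 2004, Def. 11.4;
Atserias–Dawar 2019, §2.1] [folklore] -/
def IsPartialIso (L : FirstOrder.Language.{u, v}) [L.Structure M] [L.Structure N]
    (p : PebblePosition k M N) : Prop :=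
  p.EqCompatible ∧ ∀ ⦃r : ℕ⦄ (R : L.Relations r) (a : Fin r → M) (b : Fin r → N),
    (∀ j, p.Pebbled (a j) (b j)) → (RelMap R a ↔ RelMap R b)

/-- For simple graphs `G`, `H`: the pebbled pairs respect ADJACENCY. [Cai–Fürer–Immerman 1992,
§4; Atserias–Dawar 2019, §2.1] [folklore] -/
def AdjCompatible {V : Type w} {W : Type w'} (G : SimpleGraph V) (H : SimpleGraph W)
    (p : PebblePosition k V W) : Prop :=
  ∀ ⦃a a' : V⦄ ⦃b b' : W⦄, p.Pebbled a b → p.Pebbled a' b' → (G.Adj a a' ↔ H.Adj b b')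

/-- Nothing is pebbled in the empty position. [folklore] -/
theorem not_pebbled_empty (a : M) (b : N) : ¬ (empty : PebblePosition k M N).Pebbled a b := by
  rintro ⟨i, h⟩
  simp [empty] at h

/-- Pebbled pairs after the move "pair `i` onto `(a, b)`": the new pair, or an old pair of
another pebble. [folklore] -/
theorem pebbled_update_iff (p : PebblePosition k M N) (i : Fin k) (a a' : M) (b b' : N) :
    Pebbled (Function.update p i (some (a, b))) a' b' ↔
      (a' = a ∧ b' = b) ∨ ∃ j, j ≠ i ∧ p j = some (a', b') := by
  constructor
  · rintro ⟨j, hj⟩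
    by_cases hji : j = i
    · subst hji
      rw [Function.update_self] at hj
      left
      cases hj
      exact ⟨rfl, rfl⟩
    · rw [Function.update_of_ne hji] at hj
      exact Or.inr ⟨j, hji, hj⟩
  · rintro (⟨rfl, rfl⟩ | ⟨j, hji, hj⟩)
    · exact ⟨i, by rw [Function.update_self]⟩
    · exact ⟨j, by rw [Function.update_of_ne hji, hj]⟩

/-- Unfolding of `IsPartialIso` for graphs viewed as `FirstOrder.Language.graph`-structures
(`SimpleGraph.structure`): equality- and adjacency-compatibility. [folklore] -/
theorem isPartialIso_graph_iff {V : Type w} {W : Type w'} (G : SimpleGraph V) (H : SimpleGraph W)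
    (p : PebblePosition k V W) :
    @IsPartialIso k V W FirstOrder.Language.graph G.structure H.structure p ↔
      p.EqCompatible ∧ p.AdjCompatible G H := by
  letI := G.structure; letI := H.structure
  refine and_congr_right fun _ => ⟨fun h a a' b b' hab ha'b' => ?_, fun h r R a b hab => ?_⟩
  · exact h FirstOrder.Language.adj ![a, a'] ![b, b'] (Fin.forall_fin_two.2 ⟨hab, ha'b'⟩)
  · match r, R with
    | 2, .adj => exact h (hab 0) (hab 1)

end PebblePosition

/-! ### Strategy spaces and `≡_{C^k}` for `L`-structures -/

/-- A STRATEGY SPACE FOR DUPLICATOR in the bijective `k`-pebble game on `M`, `N` (labelled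
pebble pairs), rendered positionally: a set of positions containing the empty position and
closed under the bijective move — from every position, whichever pair `i` Spoiler picks up,
Duplicator has a bijection `f : M ≃ N` such that wherever Spoiler then places pair `i` (on `a`
and `f a`) the resulting position is again in the set. It is WINNING for a notion of partial
isomorphism when all its positions are partial isomorphisms; Duplicator "can play forever
without losing" iff a winning strategy space exists (her bijection may depend on the whole
current position — history-dependence does not change who wins — and a bijection disagreeing
with the pebbled map `aⱼ ↦ bⱼ`, `j ≠ i`, loses at once through `EqCompatible`, so this is the
game of Atserias–Dawar 2019, §2.1 verbatim). [Hella 1996; Atserias–Dawar 2019, §2.1; Libkin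
2004, Def. 11.4 (positions with `k` labelled pebble pairs)] [cite: AtseriasDawar2019, §2.1] -/
structure PebbleStrategySpace (k : ℕ) (M : Type w) (N : Type w') where
  /-- the positions from which Duplicator plays -/
  positions : Set (PebblePosition k M N)
  /-- the game starts with all pebbles off the board -/
  empty_mem : PebblePosition.empty ∈ positions
  /-- the bijective move: Spoiler lifts pair `i`, Duplicator answers with a bijection `f`,
  Spoiler places pair `i` on some `(a, f a)` -/
  move : ∀ ⦃p⦄, p ∈ positions → ∀ i : Fin k, ∃ f : M ≃ N, ∀ a : M,
    Function.update p i (some (a, f a)) ∈ positions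

/-- **`C^k`-EQUIVALENCE of `L`-STRUCTURES**, `M ≡_{C^k} N`, by the bijective `k`-pebble game:
Duplicator has a strategy space all of whose positions are partial isomorphisms of `L`-structures.
For finite nonempty structures this IS agreement on all `C^k` sentences
(`structCkEquiv_iff_ckSentenceEquiv`, Hella's theorem, proved below); for graphs it IS the
tree's `CkEquiv` (`ckEquiv_iff_structCkEquiv`). With `k ≥ 1` pebble pairs equivalent structures
are equinumerous (`StructCkEquiv.nonempty_equiv`); `k = 0` only compares `0`-ary relations.
[Hella 1996; Atserias–Dawar 2019, §2.1; Cai–Fürer–Immerman 1992, §§4–5]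
[cite: AtseriasDawar2019, §2.1] -/
def StructCkEquiv (L : FirstOrder.Language.{u, v}) (k : ℕ) (M : Type w) (N : Type w')
    [L.Structure M] [L.Structure N] : Prop :=
  ∃ S : PebbleStrategySpace k M N, ∀ ⦃p⦄, p ∈ S.positions → p.IsPartialIso L

section StructAPI

variable {L : FirstOrder.Language.{u, v}} {M : Type w} {N : Type w'} [L.Structure M] [L.Structure N]

/-- Isomorphic structures are `≡_{C^k}` for every `k` (Duplicator plays the isomorphism).
[Hella 1996; Dawar–Wilsenach 2025, §2.4] [folklore] -/
theorem StructCkEquiv.of_equiv (e : M ≃[L] N) (k : ℕ) : StructCkEquiv L k M N := by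
  refine ⟨{ positions := {p | ∀ ⦃a b⦄, p.Pebbled a b → b = e a},
            empty_mem := ?_, move := ?_ }, ?_⟩
  · intro a b hab
    exact (PebblePosition.not_pebbled_empty a b hab).elim
  · intro p hp i
    refine ⟨e.toEquiv, fun a a' b' hab => ?_⟩
    rcases (PebblePosition.pebbled_update_iff p i a a' (e a) b').1 hab with ⟨rfl, rfl⟩ | ⟨j, -, hj⟩
    · rfl
    · exact hp ⟨j, hj⟩
  · intro p hp
    refine ⟨fun a a' b b' hab ha'b' => ?_, fun r R a b hab => ?_⟩
    · rw [hp hab, hp ha'b']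
      exact e.injective.eq_iff.symm
    · have hb : b = e ∘ a := funext fun j => hp (hab j)
      rw [hb]
      exact (e.map_rel R a).symm

/-- Fewer pebbles only help Duplicator: `≡_{C^k}` implies `≡_{C^j}` for `j ≤ k`. [folklore] -/
theorem StructCkEquiv.mono {j k : ℕ} (hjk : j ≤ k) (h : StructCkEquiv L k M N) :
    StructCkEquiv L j M N := by
  obtain ⟨S, hS⟩ := h
  -- view a `j`-position as a `k`-position whose pairs `≥ j` are off the board
  let ext : PebblePosition j M N → PebblePosition k M N :=
    fun q i => if hi : (i : ℕ) < j then q ⟨i, hi⟩ else none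
  have hpeb : ∀ (q : PebblePosition j M N) {a : M} {b : N}, q.Pebbled a b ↔ (ext q).Pebbled a b := by
    intro q a b
    constructor
    · rintro ⟨i, hi⟩
      exact ⟨Fin.castLE hjk i, by simp [ext, hi]⟩
    · rintro ⟨i, hi⟩
      by_cases h : (i : ℕ) < j
      · exact ⟨⟨i, h⟩, by simpa [ext, h] using hi⟩
      · simp [ext, h] at hi
  refine ⟨{ positions := {q | ext q ∈ S.positions}, empty_mem := ?_, move := ?_ }, ?_⟩
  · show ext PebblePosition.empty ∈ S.positions
    convert S.empty_mem using 1
    funext i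
    simp [ext, PebblePosition.empty]
  · intro q hq i
    obtain ⟨f, hf⟩ := S.move hq (Fin.castLE hjk i)
    refine ⟨f, fun a => ?_⟩
    show ext (Function.update q i (some (a, f a))) ∈ S.positions
    convert hf a using 1
    funext i'
    simp only [ext, Function.update_apply]
    have hci : ((Fin.castLE hjk i : Fin k) : ℕ) = i := Fin.val_castLE hjk i
    split_ifs <;> first | rfl | (exfalso; simp only [Fin.ext_iff, hci] at *; omega)
  · intro q hq
    obtain ⟨h1, h2⟩ := hS hq
    exact ⟨fun a a' b b' hab ha'b' => h1 ((hpeb q).1 hab) ((hpeb q).1 ha'b'),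
      fun r R a b hab => h2 R a b fun i => (hpeb q).1 (hab i)⟩

/-- With at least one pebble pair, `≡_{C^k}` structures are equinumerous (Duplicator's first
bijection). [Atserias–Dawar 2019, §2.1] [folklore] -/
theorem StructCkEquiv.nonempty_equiv {k : ℕ} (h : StructCkEquiv L k M N) (hk : 0 < k) :
    Nonempty (M ≃ N) := by
  obtain ⟨S, -⟩ := h
  obtain ⟨f, -⟩ := S.move S.empty_mem ⟨0, hk⟩
  exact ⟨f⟩

/-- With at least `|M|` and `|N|` pebble pairs, `≡_{C^k}` of finite structures of a relational
vocabulary is ISOMORPHISM: Spoiler pebbles all of `M`, and the final position is a bijective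
partial isomorphism (for `k = 0` both structures are empty and the empty position matches the
`0`-ary relations). [Dawar–Wilsenach 2025, §2.4; Atserias–Dawar 2019, §2.1 ("k(n) ≤ n")]
[folklore] -/
theorem StructCkEquiv.nonempty_lequiv_of_card_le [L.IsRelational] [Fintype M] [Fintype N]
    {k : ℕ} (h : StructCkEquiv L k M N) (hM : Fintype.card M ≤ k) (hN : Fintype.card N ≤ k) :
    Nonempty (M ≃[L] N) := by
  classical
  obtain ⟨S, hS⟩ := h
  rcases Nat.eq_zero_or_pos k with rfl | hk
  · haveI : IsEmpty M := Fintype.card_eq_zero_iff.1 (Nat.le_zero.1 hM)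
    haveI : IsEmpty N := Fintype.card_eq_zero_iff.1 (Nat.le_zero.1 hN)
    refine ⟨{ Equiv.equivOfIsEmpty M N with
      map_fun' := fun {n} f => isEmptyElim f
      map_rel' := fun {n} R x => ?_ }⟩
    cases n with
    | zero =>
      have hx : x = Fin.elim0 := funext fun j => j.elim0
      subst hx
      have h0 := (hS S.empty_mem).2 R (Fin.elim0 : Fin 0 → M)
        ((Equiv.equivOfIsEmpty M N) ∘ Fin.elim0) fun j => j.elim0
      have : ((Equiv.equivOfIsEmpty M N) ∘ (Fin.elim0 : Fin 0 → M)) = Fin.elim0 :=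
        funext fun j => j.elim0
      exact Iff.symm (by simpa using h0)
    | succ n => exact isEmptyElim (x 0)
  obtain ⟨eMN⟩ : Nonempty (M ≃ N) := StructCkEquiv.nonempty_equiv ⟨S, hS⟩ hk
  set m := Fintype.card M with hm
  let e : Fin m ≃ M := (Fintype.equivFin M).symm
  -- pebble `e 0, e 1, …` one at a time with pairs `0, 1, …`
  have key : ∀ t ≤ m, ∃ p ∈ S.positions,
      ∀ i : Fin m, (i : ℕ) < t → ∃ b, p (Fin.castLE hM i) = some (e i, b) := by
    intro t
    induction t with
    | zero => exact fun _ => ⟨_, S.empty_mem, fun i hi => (Nat.not_lt_zero _ hi).elim⟩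
    | succ t ih =>
      intro ht
      obtain ⟨p, hp, hpeb⟩ := ih (Nat.le_of_succ_le ht)
      have htm : t < m := ht
      obtain ⟨f, hf⟩ := S.move hp (Fin.castLE hM ⟨t, htm⟩)
      refine ⟨_, hf (e ⟨t, htm⟩), fun i hi => ?_⟩
      rcases Nat.lt_succ_iff_lt_or_eq.1 hi with hlt | heq
      · obtain ⟨b, hb⟩ := hpeb i hlt
        refine ⟨b, ?_⟩
        rw [Function.update_of_ne, hb]
        intro hh
        have := congrArg Fin.val hh
        simp only [Fin.val_castLE] at this
        omega
      · have : i = ⟨t, htm⟩ := Fin.ext heq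
        subst this
        exact ⟨f (e ⟨t, htm⟩), by rw [Function.update_self]⟩
  obtain ⟨p, hp, hpeb⟩ := key m le_rfl
  choose w hw using fun i : Fin m => hpeb i i.isLt
  obtain ⟨hEq, hRel⟩ := hS hp
  let φ : M → N := fun a => w (e.symm a)
  have hpebbled : ∀ a : M, p.Pebbled a (φ a) := fun a =>
    ⟨Fin.castLE hM (e.symm a), by rw [hw (e.symm a), Equiv.apply_symm_apply]⟩
  have hinj : Function.Injective φ := fun a a' haa' => (hEq (hpebbled a) (hpebbled a')).2 haa'
  have hbij : Function.Bijective φ :=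
    (Fintype.bijective_iff_injective_and_card φ).2 ⟨hinj, Fintype.card_congr eMN⟩
  exact ⟨({ Equiv.ofBijective φ hbij with
    map_fun' := fun {n} f => isEmptyElim f
    map_rel' := fun {n} R x => (hRel R x (φ ∘ x) fun j => hpebbled (x j)).symm } : L.Equiv M N)⟩

end StructAPI

/-! ### The bridge to the tree's `CkEquiv` (graphs, unlabelled positions) -/

section Bridge

variable {V : Type w} {W : Type w'} {k : ℕ}

namespace PebblePosition

/-- The SET OF PEBBLED PAIRS of a labelled position (the unlabelled position it induces).
[Grohe–Otto 2015, §2] [folklore] -/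
def pairs (p : PebblePosition k V W) : Set (V × W) := {x | ∃ i, p i = some x}

/-- Membership in `pairs`. [folklore] -/
theorem mem_pairs_iff (p : PebblePosition k V W) (a : V) (b : W) :
    (a, b) ∈ p.pairs ↔ p.Pebbled a b := Iff.rfl

/-- The empty position has no pairs. [folklore] -/
theorem pairs_empty : (empty : PebblePosition k V W).pairs = ∅ := by
  ext x; simp [pairs, empty]

/-- `pairs` is finite (at most `k` pebbles). [folklore] -/
theorem pairs_finite (p : PebblePosition k V W) : p.pairs.Finite := by
  have h : p.pairs = Option.some ⁻¹' Set.range p := by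
    ext x
    simp [pairs]
  rw [h]
  exact (Set.finite_range p).preimage (Option.some_injective _).injOn

/-- Pairs after a move: the new pair together with the pairs of the other pebbles. [folklore] -/
theorem pairs_update (p : PebblePosition k V W) (i : Fin k) (a : V) (b : W) :
    pairs (Function.update p i (some (a, b))) =
      insert (a, b) (pairs (Function.update p i none)) := by
  ext ⟨a', b'⟩
  simp only [pairs, Set.mem_setOf_eq, Set.mem_insert_iff, Prod.mk.injEq]
  constructor
  · rintro ⟨j, hj⟩
    by_cases hji : j = i
    · subst hji
      rw [Function.update_self] at hj
      cases hj
      exact Or.inl ⟨rfl, rfl⟩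
    · exact Or.inr ⟨j, by rw [Function.update_of_ne hji]; rwa [Function.update_of_ne hji] at hj⟩
  · rintro (⟨rfl, rfl⟩ | ⟨j, hj⟩)
    · exact ⟨i, by rw [Function.update_self]⟩
    · by_cases hji : j = i
      · subst hji; rw [Function.update_self] at hj; cases hj
      · exact ⟨j, by rw [Function.update_of_ne hji]; rwa [Function.update_of_ne hji] at hj⟩

/-- Lifting a pebble shrinks the set of pairs. [folklore] -/
theorem pairs_update_none_subset (p : PebblePosition k V W) (i : Fin k) :
    pairs (Function.update p i none) ⊆ p.pairs := by
  rintro x ⟨j, hj⟩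
  by_cases hji : j = i
  · subst hji; rw [Function.update_self] at hj; cases hj
  · exact ⟨j, by rwa [Function.update_of_ne hji] at hj⟩

/-- After lifting pebble `i` fewer than `k` pairs remain (they are pebbled by the other `k - 1`
pairs). [folklore] -/
theorem ncard_pairs_update_none_lt (p : PebblePosition k V W) (i : Fin k) :
    (pairs (Function.update p i none)).ncard < k := by
  classical
  haveI : Nonempty (Fin k) := ⟨i⟩
  set q := Function.update p i none with hq
  -- an injective choice of a pebble `≠ i` for every remaining pair
  have hw : ∀ x ∈ pairs q, ∃ j : Fin k, j ≠ i ∧ p j = some x := by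
    rintro x ⟨j, hj⟩
    by_cases hji : j = i
    · subst hji; rw [hq, Function.update_self] at hj; cases hj
    · exact ⟨j, hji, by rwa [hq, Function.update_of_ne hji] at hj⟩
  choose! wit hwit_ne hwit using hw
  have hle : (pairs q).ncard ≤ ({j : Fin k | j ≠ i} : Set (Fin k)).ncard :=
    Set.ncard_le_ncard_of_injOn wit (fun x hx => hwit_ne x hx)
      (fun x hx y hy hxy => Option.some_injective _ ((hwit x hx).symm.trans (hxy ▸ hwit y hy)))
      (Set.toFinite _)
  have hne : ({j : Fin k | j ≠ i} : Set (Fin k)).ncard < k := by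
    have h1 : ({j : Fin k | j ≠ i} : Set (Fin k)) = ↑(Finset.univ.erase i) := by
      ext j; simp
    rw [h1, Set.ncard_coe_finset, Finset.card_erase_of_mem (Finset.mem_univ i), Finset.card_univ,
      Fintype.card_fin]
    exact Nat.sub_lt (Fin.pos i) one_pos
  exact hle.trans_lt hne

end PebblePosition

/-- **The two presentations of the bijective `k`-pebble game agree**: for simple graphs the tree's
`CkEquiv k G H` (unlabelled positions `p ⊆ V × W` with `≤ k` pairs, subset-closed
back-and-forth systems; Grohe–Otto 2015, §2) holds iff `StructCkEquiv Language.graph k` does for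
`SimpleGraph.structure` (labelled pebble pairs; Libkin 2004 Def. 11.4, Atserias–Dawar 2019
§2.1). (→): a labelled position is winning when its set of pairs is; lifting pair `i` leaves
`< k` pairs, so the forth property supplies the bijection. (←): an unlabelled position is winning
when it has `≤ k` pairs and is covered by the pairs of a winning labelled position; given fewer
than `k` pairs, some pebble is not needed to cover them and can be moved. [folklore] -/
theorem ckEquiv_iff_structCkEquiv (k : ℕ) (G : SimpleGraph V) (H : SimpleGraph W) :
    CkEquiv k G H ↔ @StructCkEquiv FirstOrder.Language.graph k V W G.structure H.structure := by
  classical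
  constructor
  · rintro ⟨T⟩
    refine ⟨{ positions := {p | p.pairs ∈ T.carrier}, empty_mem := ?_, move := ?_ }, ?_⟩
    · show PebblePosition.empty.pairs ∈ T.carrier
      rw [PebblePosition.pairs_empty]; exact T.empty_mem
    · intro p hp i
      have hq : PebblePosition.pairs (Function.update p i none) ∈ T.carrier :=
        T.mem_of_subset hp (p.pairs_update_none_subset i)
      obtain ⟨f, hf⟩ := T.forth hq (p.ncard_pairs_update_none_lt i)
      refine ⟨f, fun a => ?_⟩
      show PebblePosition.pairs (Function.update p i (some (a, f a))) ∈ T.carrier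
      rw [PebblePosition.pairs_update]
      exact hf a
    · intro p hp
      rw [PebblePosition.isPartialIso_graph_iff]
      have hP := T.isPartialIso_of_mem hp
      exact ⟨fun a a' b b' hab ha'b' => hP.eq_iff (x := (a, b)) (y := (a', b')) hab ha'b',
        fun a a' b b' hab ha'b' => hP.adj_iff (x := (a, b)) (y := (a', b')) hab ha'b'⟩
  · rintro ⟨S, hS⟩
    have hS' : ∀ ⦃p⦄, p ∈ S.positions → p.EqCompatible ∧ p.AdjCompatible G H := fun p hp =>
      (PebblePosition.isPartialIso_graph_iff G H p).1 (hS hp)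
    refine ⟨{ carrier := {q | q.ncard ≤ k ∧ ∃ p ∈ S.positions, q ⊆ p.pairs}
              empty_mem := ⟨by simp, PebblePosition.empty, S.empty_mem, Set.empty_subset _⟩
              finite_of_mem := fun q ⟨_, p, _, hqp⟩ => (p.pairs_finite).subset hqp
              ncard_le_of_mem := fun q hq => hq.1
              isPartialIso_of_mem := ?_
              mem_of_subset := fun q ⟨hqk, p, hp, hqp⟩ q' hq' =>
                ⟨(Set.ncard_le_ncard hq' ((p.pairs_finite).subset hqp)).trans hqk, p, hp,
                  hq'.trans hqp⟩
              forth := ?_ }⟩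
    · rintro q ⟨-, p, hp, hqp⟩
      obtain ⟨h1, h2⟩ := hS' hp
      exact ⟨fun x hx y hy => h1 (hqp hx) (hqp hy), fun x hx y hy => h2 (hqp hx) (hqp hy)⟩
    · rintro q ⟨hqk, p, hp, hqp⟩ hqlt
      have hfin : q.Finite := (p.pairs_finite).subset hqp
      -- an injective choice of a covering pebble for every pair of `q`
      have hw : ∀ x ∈ q, ∃ j : Fin k, p j = some x := fun x hx => hqp hx
      haveI : Nonempty (Fin k) := ⟨⟨0, by omega⟩⟩
      choose! wit hwit using hw
      have hinj : Set.InjOn wit q := fun x hx y hy hxy =>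
        Option.some_injective _ ((hwit x hx).symm.trans (hxy ▸ hwit y hy))
      -- some pebble `i` is not used
      obtain ⟨i, hi⟩ : ∃ i : Fin k, i ∉ wit '' q := by
        by_contra hall
        push Not at hall
        have huniv : wit '' q = Set.univ := Set.eq_univ_iff_forall.2 hall
        have h1 : (wit '' q).ncard = q.ncard := hinj.ncard_image
        have h2 : (Set.univ : Set (Fin k)).ncard = k := by rw [Set.ncard_univ, Nat.card_fin]
        rw [huniv, h2] at h1
        omega
      obtain ⟨f, hf⟩ := S.move hp i
      refine ⟨f, fun a => ⟨(Set.ncard_insert_le _ _).trans (by omega), _, hf a, ?_⟩⟩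
      rw [PebblePosition.pairs_update]
      refine Set.insert_subset_insert fun x hx => ⟨wit x, ?_⟩
      have hne : wit x ≠ i := fun h => hi ⟨x, hx, h⟩
      rw [Function.update_of_ne hne]
      exact hwit x hx

end Bridge

end Literature.ModelTheory.FiniteModelTheory
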